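import Mathlib
import Literature.NumberTheory.LFunctions.Zhang2022.TypedSection10A
import Literature.NumberTheory.LFunctions.Zhang2022.Section3Lemma31
import HarnessLib

/-!
# Zhang (2022) §10, (10.11) on the middle window: what the displayed evaluation Z22:§10.u021 gives
# — `𝔳₂ⱼ(d,r) ≪ (1 + |Π(d,r)|)𝓛⁻⁷` for `P^{0.502}/T < dr ≤ P^{0.502}`, kernel-checked

Topic `Literature/NumberTheory/LFunctions/Zhang2022` (Landau–Siegel audit tree; verdict-neutral).
Y. Zhang, *Discrete mean estimates and the Landau–Siegel zero*, arXiv:2211.02515v1 (2022)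
[Zhang2022LandauSiegel] — **an unrefereed manuscript under adjudication; nothing here asserts or
denies its Theorems 1–2, and no claim about Landau–Siegel zeros is made.** Cell siegel-zhang, D-0069
campaign, discharge seat sz-d60; companion of plan/GAP-LEDGER row G-d60-1 (Z22:(10.11)).

Lemma 10.2's fourth clause (10.11) [Z22 p.55, tex L2817]: "if `dr ∈ (P^{0.5}/T, P^{0.5}] ∪
(P^{0.502}/T, P^{0.502}] ∪ (P^{0.504}/T, P^{0.504})`, then `𝔳₂ⱼ(d,r) ≪ 𝓛⁻⁷`", with the printed proof
"The proof of (10.11) is similar to that of (10.5) in the case `y ∈ (P^{0.502}/T, P^{0.502}]`" (tex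
L2853) — no display (GAP row G-d60-1; the typed node `Typed.Sec10A.Eq1011` carries a constant uniform
in `d, r`). This file records, in the kernel, what the DISPLAYED evaluation of the same proof gives on
the middle window: the display Z22:§10.u021 AS PRINTED (`Typed.Sec10A.Step10u021`, range
`P^{0.5}/T < dr ≤ P^{0.502}`, which CONTAINS the middle window) evaluates
`𝔳₂ⱼ(d,r) = (500L′(1,χ)Π(d,r)/log P)·(−1 + 𝔶₁ⱼ(dr)) + O(𝓛⁻¹⁵)` (the circle integral is exactly
`−1 + 𝔶₁ⱼ(dr)`, L3-t1's `residue102b_eq`); with `|L′(1,χ)| ≤ 2e^{9/2}(1+𝓛)𝓛` (tree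
`Lemma31.norm_deriv_LFunction_le_near_one`, Cauchy's estimate), `log P = 𝓛⁹`, and
`|𝔶₁ⱼ(y)| ≤ 4b₀ + 6b₀²` for `1 ≤ y ≤ P` (`|β_j| ≤ b₀/𝓛⁹`, `b₀ = 3π(1+5|c′|π)`; the logarithms are
`≤ 2𝓛⁹`), this yields

* `eq1011_mid_weak_of_step10u021 : Step10u021 c′ → ∃ C, ForAllLarge (A → ∀ j ∈ {1,2,3}, ∀ d r ≥ 1,
  P^{0.502}/T < dr ≤ P^{0.502} → ‖𝔳₂ⱼ(d,r)‖ ≤ C·(1 + ‖Π(d,r)‖)·(𝓛⁷)⁻¹)` —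

i.e. (10.11) on the middle window WITH the factor `1 + |Π(d,r)|` (`Π(d,r) = Skeleton.PiW`, Lemma
8.3's Euler factor, of size up to `≍ log log(dr)`): the printed `𝓛⁻⁷` is exactly the size of the
displayed main term (`𝓛²·𝓛⁻⁹`), so (10.11) there is the statement that the main term is of its
trivial size — but uniformly in `d, r` only up to `Π(d,r)`. The two outer windows
`(P^{0.5}/T, P^{0.5}]`, `(P^{0.504}/T, P^{0.504})` are covered by no display. This theorem is a
CONSEQUENCE of the typed display, recorded next to the gap; it is not the node `Eq1011` and does not
close it. No new definitions, no new facts; standard axioms.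

## References

* Y. Zhang, arXiv:2211.02515v1 (2022), §10 Lemma 10.2, (10.9), (10.11), p. 55 tex L2798–L2817, and
  the proof displays p. 56 tex L2842–L2853; (2.10), (2.13). [cite: Zhang2022LandauSiegel, §10 (10.11)]
-/

noncomputable section

open Complex Real Metric Set MeasureTheory

namespace Literature.NumberTheory.LFunctions.Zhang2022.Typed.Sec10A

open Literature.NumberTheory.LFunctions.Zhang2022.Skeleton

section MiddleWindow

variable (c' : ℝ)

/-- `log P = 𝓛⁹`. [cite: Zhang2022LandauSiegel, §2 (2.6)] -/
private theorem log_bigP' (D : ℕ) : Real.log (bigP D) = ell D ^ 9 := by rw [bigP, Real.log_exp]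

/-- `α𝓛⁹ = π`. [cite: Zhang2022LandauSiegel, §2 (2.10)] -/
private theorem alpha_mul_ell9 {D : ℕ} (hD : 3 ≤ D) : alpha D * ell D ^ 9 = π := by
  have h9 : 0 < ell D ^ 9 := pow_pos (by linarith [one_lt_ell hD]) _
  rw [alpha, log_bigP', div_mul_cancel₀ _ h9.ne']

/-- `α𝓛 ≤ π` (`= π/𝓛⁸`, `𝓛 ≥ 1`). [cite: Zhang2022LandauSiegel, §2 (2.10)] -/
private theorem alpha_mul_ell_le {D : ℕ} (hD : 3 ≤ D) : alpha D * ell D ≤ π := by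
  have h1 : 1 < ell D := one_lt_ell hD
  have hα : 0 < alpha D := by
    rw [alpha, log_bigP']; exact div_pos Real.pi_pos (pow_pos (by linarith) _)
  calc alpha D * ell D = alpha D * ell D ^ 1 := by rw [pow_one]
    _ ≤ alpha D * ell D ^ 9 :=
        mul_le_mul_of_nonneg_left (pow_le_pow_right₀ h1.le (by norm_num)) hα.le
    _ = π := alpha_mul_ell9 hD

/-- **`‖β_j‖·𝓛⁹ ≤ b₀ := 3π(1 + 5|c′|π)`** for every `j` ((2.13): `β₁ = iα(1−5c′α𝓛)`,
`β₂ = 2iα(1+c′α𝓛)`, `β₃ = 3iα(1−c′α𝓛)`, `α𝓛⁹ = π`, `α𝓛 ≤ π`). [cite: Zhang2022LandauSiegel, §2 (2.13)] -/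
theorem norm_betaJ_mul_ell9_le {D : ℕ} (hD : 3 ≤ D) (j : ℕ) :
    ‖betaJ c' D j‖ * ell D ^ 9 ≤ 3 * π * (1 + 5 * |c'| * π) := by
  have hα : 0 < alpha D := by
    rw [alpha, log_bigP']; exact div_pos Real.pi_pos (pow_pos (by linarith [one_lt_ell hD]) _)
  have hαℓ := alpha_mul_ell_le hD
  have hαℓ0 : 0 ≤ alpha D * ell D := mul_nonneg hα.le (by linarith [one_lt_ell hD])
  have hπ := Real.pi_pos
  have h9 := alpha_mul_ell9 hD
  -- the three perturbation factors
  have hf1 : |1 - 5 * c' * alpha D * ell D| ≤ 1 + 5 * |c'| * π := by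
    calc |1 - 5 * c' * alpha D * ell D| ≤ |1| + |5 * c' * alpha D * ell D| := abs_sub _ _
      _ = 1 + 5 * |c'| * (alpha D * ell D) := by
          rw [abs_one, show 5 * c' * alpha D * ell D = 5 * c' * (alpha D * ell D) by ring,
            abs_mul, abs_mul, abs_of_nonneg hαℓ0]; norm_num
      _ ≤ 1 + 5 * |c'| * π := by gcongr
  have hf2 : |1 + c' * alpha D * ell D| ≤ 1 + 5 * |c'| * π := by
    calc |1 + c' * alpha D * ell D| ≤ |1| + |c' * alpha D * ell D| := abs_add_le _ _
      _ = 1 + |c'| * (alpha D * ell D) := by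
          rw [abs_one, mul_assoc, abs_mul, abs_of_nonneg hαℓ0]
      _ ≤ 1 + |c'| * π := by gcongr
      _ ≤ 1 + 5 * |c'| * π := by nlinarith [abs_nonneg c']
  have hf3 : |1 - c' * alpha D * ell D| ≤ 1 + 5 * |c'| * π := by
    calc |1 - c' * alpha D * ell D| ≤ |1| + |c' * alpha D * ell D| := abs_sub _ _
      _ = 1 + |c'| * (alpha D * ell D) := by
          rw [abs_one, mul_assoc, abs_mul, abs_of_nonneg hαℓ0]
      _ ≤ 1 + |c'| * π := by gcongr
      _ ≤ 1 + 5 * |c'| * π := by nlinarith [abs_nonneg c']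
  have hK : 0 ≤ 1 + 5 * |c'| * π := by positivity
  unfold betaJ
  split_ifs
  · -- β₁
    rw [beta1, norm_mul, norm_mul, Complex.norm_I, one_mul, Complex.norm_real, Complex.norm_real,
      Real.norm_eq_abs, Real.norm_eq_abs, abs_of_pos hα]
    calc alpha D * |1 - 5 * c' * alpha D * ell D| * ell D ^ 9
        = (alpha D * ell D ^ 9) * |1 - 5 * c' * alpha D * ell D| := by ring
      _ ≤ π * (1 + 5 * |c'| * π) := by rw [h9]; gcongr
      _ ≤ 3 * π * (1 + 5 * |c'| * π) := by nlinarith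
  · -- β₂
    rw [beta2, norm_mul, norm_mul, norm_mul, Complex.norm_I, Complex.norm_real, Complex.norm_real,
      Real.norm_eq_abs, Real.norm_eq_abs, abs_of_pos hα]
    simp only [Complex.norm_ofNat, mul_one]
    calc 2 * alpha D * |1 + c' * alpha D * ell D| * ell D ^ 9
        = 2 * (alpha D * ell D ^ 9) * |1 + c' * alpha D * ell D| := by ring
      _ ≤ 2 * π * (1 + 5 * |c'| * π) := by rw [h9]; gcongr
      _ ≤ 3 * π * (1 + 5 * |c'| * π) := by nlinarith
  · -- β₃
    rw [beta3, norm_mul, norm_mul, norm_mul, Complex.norm_I, Complex.norm_real, Complex.norm_real,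
      Real.norm_eq_abs, Real.norm_eq_abs, abs_of_pos hα]
    simp only [Complex.norm_ofNat, mul_one]
    calc 3 * alpha D * |1 - c' * alpha D * ell D| * ell D ^ 9
        = 3 * (alpha D * ell D ^ 9) * |1 - c' * alpha D * ell D| := by ring
      _ ≤ 3 * π * (1 + 5 * |c'| * π) := by rw [h9]; gcongr

/-- For `1 ≤ y ≤ P` and `0 ≤ θ ≤ 1`: `|log(y/P^θ)| ≤ 2𝓛⁹` and `|log(P^θ/y)| ≤ 2𝓛⁹`.
[cite: Zhang2022LandauSiegel, §10 (10.9)] -/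
private theorem abs_log_div_le {D : ℕ} {y θ : ℝ} (hy1 : 1 ≤ y) (hyP : y ≤ bigP D) (hθ0 : 0 ≤ θ)
    (hθ1 : θ ≤ 1) :
    |Real.log (y / bigP D ^ θ)| ≤ 2 * ell D ^ 9 ∧ |Real.log (bigP D ^ θ / y)| ≤ 2 * ell D ^ 9 := by
  have hP : 0 < bigP D := Real.exp_pos _
  have hPθ : 0 < bigP D ^ θ := Real.rpow_pos_of_pos hP _
  have hy0 : 0 < y := by linarith
  have hℓ9 : 0 ≤ ell D ^ 9 := pow_nonneg (Real.log_natCast_nonneg D) 9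
  have hlogy0 : 0 ≤ Real.log y := Real.log_nonneg hy1
  have hlogyP : Real.log y ≤ ell D ^ 9 := by
    rw [← log_bigP']; exact Real.log_le_log hy0 hyP
  have hlogPθ : Real.log (bigP D ^ θ) = θ * ell D ^ 9 := by rw [Real.log_rpow hP, log_bigP']
  have hθℓ : θ * ell D ^ 9 ≤ ell D ^ 9 := by nlinarith
  have hθℓ0 : 0 ≤ θ * ell D ^ 9 := by positivity
  have e1 : Real.log (y / bigP D ^ θ) = Real.log y - θ * ell D ^ 9 := by
    rw [Real.log_div hy0.ne' hPθ.ne', hlogPθ]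
  have e2 : Real.log (bigP D ^ θ / y) = θ * ell D ^ 9 - Real.log y := by
    rw [Real.log_div hPθ.ne' hy0.ne', hlogPθ]
  constructor
  · rw [e1, abs_le]; constructor <;> linarith
  · rw [e2, abs_le]; constructor <;> linarith

/-- **`|𝔶₁ⱼ(y)| ≤ 4b₀ + 6b₀²`** for `1 ≤ y ≤ P`, `b₀ = 3π(1 + 5|c′|π)` (`Skeleton.fraky1`; every shift
has `|β|𝓛⁹ ≤ b₀`, every logarithm is `≤ 2𝓛⁹`). [cite: Zhang2022LandauSiegel, §10 (10.9)] -/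
theorem norm_fraky1_le {D : ℕ} (hD : 3 ≤ D) (j : ℕ) {y : ℝ} (hy1 : 1 ≤ y) (hyP : y ≤ bigP D) :
    ‖fraky1 c' D j y‖ ≤
      4 * (3 * π * (1 + 5 * |c'| * π)) + 6 * (3 * π * (1 + 5 * |c'| * π)) ^ 2 := by
  set b₀ : ℝ := 3 * π * (1 + 5 * |c'| * π) with hb₀
  have hb₀0 : 0 ≤ b₀ := by positivity
  have hℓ : 0 < ell D := by linarith [one_lt_ell hD]
  have hℓ9 : 0 < ell D ^ 9 := pow_pos hℓ 9
  -- the shifts, as bounds `‖β‖ ≤ b₀/𝓛⁹`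
  have hβ : ∀ k : ℕ, ‖betaJ c' D k‖ ≤ b₀ / ell D ^ 9 := fun k => by
    rw [le_div_iff₀ hℓ9]; exact norm_betaJ_mul_ell9_le c' hD k
  have hβ1 := hβ (j + 1)
  have hβ2 := hβ (j + 2)
  -- the logarithms
  obtain ⟨l05, -⟩ := abs_log_div_le (D := D) (θ := 0.5) hy1 hyP (by norm_num) (by norm_num)
  obtain ⟨-, l504⟩ := abs_log_div_le (D := D) (θ := 0.504) hy1 hyP (by norm_num) (by norm_num)
  obtain ⟨-, l502⟩ := abs_log_div_le (D := D) (θ := 0.502) hy1 hyP (by norm_num) (by norm_num)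
  -- assemble
  rw [fraky1]
  have n1 : ‖(betaJ c' D (j + 1) + betaJ c' D (j + 2)) *
      (Real.log (y / bigP D ^ (0.5 : ℝ)) : ℂ)‖ ≤ 4 * b₀ := by
    rw [norm_mul, Complex.norm_real, Real.norm_eq_abs]
    calc ‖betaJ c' D (j + 1) + betaJ c' D (j + 2)‖ * |Real.log (y / bigP D ^ (0.5 : ℝ))|
        ≤ (b₀ / ell D ^ 9 + b₀ / ell D ^ 9) * (2 * ell D ^ 9) := by
          gcongr
          exact (norm_add_le _ _).trans (add_le_add hβ1 hβ2)
      _ = 4 * b₀ := by field_simp; ring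
  have n2 : ‖betaJ c' D (j + 1) * betaJ c' D (j + 2) / 2 *
      ((Real.log (bigP D ^ (0.504 : ℝ) / y) : ℂ) ^ 2 -
        2 * (Real.log (bigP D ^ (0.502 : ℝ) / y) : ℂ) ^ 2)‖ ≤ 6 * b₀ ^ 2 := by
    rw [norm_mul, norm_div, norm_mul, Complex.norm_ofNat]
    have hsq : ‖((Real.log (bigP D ^ (0.504 : ℝ) / y) : ℂ) ^ 2 -
        2 * (Real.log (bigP D ^ (0.502 : ℝ) / y) : ℂ) ^ 2)‖ ≤ 12 * (ell D ^ 9) ^ 2 := by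
      calc ‖((Real.log (bigP D ^ (0.504 : ℝ) / y) : ℂ) ^ 2 -
            2 * (Real.log (bigP D ^ (0.502 : ℝ) / y) : ℂ) ^ 2)‖
          ≤ ‖((Real.log (bigP D ^ (0.504 : ℝ) / y) : ℂ) ^ 2)‖ +
              ‖2 * (Real.log (bigP D ^ (0.502 : ℝ) / y) : ℂ) ^ 2‖ := norm_sub_le _ _
        _ = |Real.log (bigP D ^ (0.504 : ℝ) / y)| ^ 2 +
              2 * |Real.log (bigP D ^ (0.502 : ℝ) / y)| ^ 2 := by
            rw [norm_pow, norm_mul, norm_pow, Complex.norm_real, Complex.norm_real,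
              Complex.norm_ofNat, Real.norm_eq_abs, Real.norm_eq_abs]
        _ ≤ (2 * ell D ^ 9) ^ 2 + 2 * (2 * ell D ^ 9) ^ 2 := by gcongr
        _ = 12 * (ell D ^ 9) ^ 2 := by ring
    calc ‖betaJ c' D (j + 1)‖ * ‖betaJ c' D (j + 2)‖ / 2 *
          ‖((Real.log (bigP D ^ (0.504 : ℝ) / y) : ℂ) ^ 2 -
            2 * (Real.log (bigP D ^ (0.502 : ℝ) / y) : ℂ) ^ 2)‖
        ≤ (b₀ / ell D ^ 9) * (b₀ / ell D ^ 9) / 2 * (12 * (ell D ^ 9) ^ 2) := by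
          gcongr
      _ = 6 * b₀ ^ 2 := by field_simp; ring
  exact (norm_add_le _ _).trans (add_le_add n1 n2)

/-- **(10.11) on the middle window from the displayed evaluation u021, with the factor `1 + |Π(d,r)|`.**
From `Typed.Sec10A.Step10u021` (AS PRINTED: for `P^{0.5}/T < dr ≤ P^{0.502}`,
`𝔳₂ⱼ(d,r) = (500L′(1,χ)Π(d,r)/log P)·[circle integral] + O(𝓛⁻¹⁵)`), the exact evaluation of the circle
integral (`residue102b_eq`: `= −1 + 𝔶₁ⱼ(dr)`), `|L′(1,χ)| ≤ 2e^{9/2}(1+𝓛)𝓛` and `|𝔶₁ⱼ| ≤ 4b₀ + 6b₀²`: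
for `P^{0.502}/T < dr ≤ P^{0.502}`, `‖𝔳₂ⱼ(d,r)‖ ≤ C(1 + ‖Π(d,r)‖)𝓛⁻⁷`. The printed (10.11) claims
`≪ 𝓛⁻⁷` with no `Π(d,r)`; its proof is not displayed (GAP row G-d60-1).
[cite: Zhang2022LandauSiegel, §10 (10.11) p. 55 and p. 56 tex L2842–L2853] -/
theorem eq1011_mid_weak_of_step10u021 (h : Step10u021 c') :
    ∃ C : ℝ, ForAllLarge fun D _ χ => AssumptionA D χ → ∀ j ∈ ({1, 2, 3} : Finset ℕ), ∀ d r : ℕ,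
      1 ≤ d → 1 ≤ r →
        bigP D ^ (0.502 : ℝ) / bigT D < ((d * r : ℕ) : ℝ) → ((d * r : ℕ) : ℝ) ≤ bigP D ^ (0.502 : ℝ) →
          ‖frakv2 c' χ j d r‖ ≤ C * (1 + ‖PiW χ d r‖) * (ell D ^ 7)⁻¹ := by
  obtain ⟨C, D₀, hC⟩ := h
  set b₀ : ℝ := 3 * π * (1 + 5 * |c'| * π) with hb₀
  set K : ℝ := 500 * (2 * Real.exp (9 / 2) * 2) * (1 + (4 * b₀ + 6 * b₀ ^ 2)) with hK
  refine ⟨|C| + K, max D₀ ⌈Real.exp 3⌉₊, fun D _ χ hD hq hp hA j hj d r hd hr h1 h2 => ?_⟩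
  have hD₀ : D₀ ≤ D := le_trans (le_max_left _ _) hD
  have hD3r : 3 ≤ ell D := by
    have h' : Real.exp 3 ≤ D := le_trans (Nat.le_ceil _) (by exact_mod_cast le_trans (le_max_right _ _) hD)
    exact (Real.le_log_iff_exp_le (lt_of_lt_of_le (Real.exp_pos _) h')).mpr h'
  have hD3 : 3 ≤ D := by
    by_contra hlt
    have : (D : ℝ) ≤ 2 := by exact_mod_cast (by omega : D ≤ 2)
    have h' : Real.exp 3 ≤ D := le_trans (Nat.le_ceil _) (by exact_mod_cast le_trans (le_max_right _ _) hD)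
    have := Real.add_one_le_exp (3 : ℝ)
    linarith
  have hℓ : 0 < ell D := by linarith
  have hα : 0 < alpha D := by
    rw [alpha, log_bigP']; exact div_pos Real.pi_pos (pow_pos hℓ _)
  -- the window sits inside u021's range
  have hT : 1 ≤ bigT D := by rw [bigT]; exact Real.one_le_exp (by positivity)
  have hP0 : 0 < bigP D := Real.exp_pos _
  have hPone : 1 ≤ bigP D := by rw [bigP]; exact Real.one_le_exp (by positivity)
  have hP5 : bigP D ^ (0.5 : ℝ) ≤ bigP D ^ (0.502 : ℝ) :=
    Real.rpow_le_rpow_of_exponent_le hPone (by norm_num)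
  have h1' : bigP D ^ (0.5 : ℝ) / bigT D < ((d * r : ℕ) : ℝ) :=
    lt_of_le_of_lt (div_le_div_of_nonneg_right hP5 (by linarith)) h1
  have key := hC D χ hD₀ hq hp hA j hj d r hd hr h1' h2
  -- evaluate the circle integral
  have hy : 0 < ((d * r : ℕ) : ℝ) := by
    have : 1 ≤ d * r := Nat.one_le_iff_ne_zero.mpr (Nat.mul_ne_zero (by omega) (by omega))
    exact_mod_cast this
  have hcast : ((d * r : ℕ) : ℂ) = (((d * r : ℕ) : ℝ) : ℂ) := by push_cast; rfl
  rw [hcast, residue102b_eq c' D j hy (by positivity : 0 < 10 * alpha D)] at key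
  -- sizes
  have hy1 : 1 ≤ ((d * r : ℕ) : ℝ) := by
    have : 1 ≤ d * r := Nat.one_le_iff_ne_zero.mpr (Nat.mul_ne_zero (by omega) (by omega))
    exact_mod_cast this
  have hyP : ((d * r : ℕ) : ℝ) ≤ bigP D := h2.trans (by
    calc bigP D ^ (0.502 : ℝ) ≤ bigP D ^ (1 : ℝ) := Real.rpow_le_rpow_of_exponent_le hPone (by norm_num)
      _ = bigP D := Real.rpow_one _)
  have hfrak : ‖(-1 : ℂ) + fraky1 c' D j ((d * r : ℕ) : ℝ)‖ ≤ 1 + (4 * b₀ + 6 * b₀ ^ 2) := by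
    refine (norm_add_le _ _).trans ?_
    rw [norm_neg, norm_one]
    have := norm_fraky1_le c' hD3 j hy1 hyP
    linarith
  have hL' : ‖deriv χ.LFunction 1‖ ≤ 2 * Real.exp (9 / 2) * (1 + ell D) * ell D :=
    Lemma31.norm_deriv_LFunction_le_near_one χ hD3r hp (w := 1)
      (by rw [sub_self, norm_zero]; positivity)
  have hlogP : (Real.log (bigP D) : ℂ) = ((ell D ^ 9 : ℝ) : ℂ) := by rw [log_bigP']
  -- the main term's norm
  have hmain : ‖(500 : ℂ) * deriv χ.LFunction 1 * PiW χ d r / (Real.log (bigP D) : ℂ) *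
      (-1 + fraky1 c' D j ((d * r : ℕ) : ℝ))‖ ≤ K * ‖PiW χ d r‖ * (ell D ^ 7)⁻¹ := by
    rw [hlogP, norm_mul, norm_div, norm_mul, norm_mul, Complex.norm_real, Real.norm_eq_abs,
      abs_of_pos (pow_pos hℓ 9)]
    simp only [Complex.norm_ofNat]
    have h1ℓ : (1 + ell D) * ell D ≤ 2 * ell D ^ 2 := by nlinarith
    set S : ℝ := 4 * b₀ + 6 * b₀ ^ 2 with hS
    have hprod : ‖deriv χ.LFunction 1‖ * ‖(-1 : ℂ) + fraky1 c' D j ((d * r : ℕ) : ℝ)‖ ≤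
        (2 * Real.exp (9 / 2) * (1 + ell D) * ell D) * (1 + S) :=
      mul_le_mul hL' hfrak (norm_nonneg _) (by positivity)
    have hprod' : (2 * Real.exp (9 / 2) * (1 + ell D) * ell D) * (1 + S) ≤
        (2 * Real.exp (9 / 2) * (2 * ell D ^ 2)) * (1 + S) := by
      have hS0 : 0 ≤ 1 + S := by positivity
      have he : 0 ≤ 2 * Real.exp (9 / 2) := by positivity
      nlinarith [mul_nonneg he hS0]
    calc 500 * ‖deriv χ.LFunction 1‖ * ‖PiW χ d r‖ / ell D ^ 9 *
          ‖(-1 : ℂ) + fraky1 c' D j ((d * r : ℕ) : ℝ)‖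
        = 500 * ‖PiW χ d r‖ / ell D ^ 9 *
            (‖deriv χ.LFunction 1‖ * ‖(-1 : ℂ) + fraky1 c' D j ((d * r : ℕ) : ℝ)‖) := by ring
      _ ≤ 500 * ‖PiW χ d r‖ / ell D ^ 9 * ((2 * Real.exp (9 / 2) * (2 * ell D ^ 2)) * (1 + S)) :=
          mul_le_mul_of_nonneg_left (hprod.trans hprod') (by positivity)
      _ = K * ‖PiW χ d r‖ * (ell D ^ 7)⁻¹ := by
          rw [hK]
          field_simp
  -- conclude
  have h15le7 : (ell D ^ 15)⁻¹ ≤ (ell D ^ 7)⁻¹ := by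
    apply inv_anti₀ (pow_pos hℓ 7)
    exact pow_le_pow_right₀ (by linarith) (by norm_num)
  have hK0 : 0 ≤ K := by positivity
  have h7 : 0 ≤ (ell D ^ 7)⁻¹ := inv_nonneg.mpr (pow_nonneg hℓ.le 7)
  have hPi : 0 ≤ ‖PiW χ d r‖ := norm_nonneg _
  have key' : ‖frakv2 c' χ j d r - (500 : ℂ) * deriv χ.LFunction 1 * PiW χ d r /
      (Real.log (bigP D) : ℂ) * (-1 + fraky1 c' D j ((d * r : ℕ) : ℝ))‖ ≤ |C| * (ell D ^ 7)⁻¹ :=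
    calc _ ≤ C * (ell D ^ 15)⁻¹ := key
      _ ≤ |C| * (ell D ^ 15)⁻¹ :=
          mul_le_mul_of_nonneg_right (le_abs_self C) (inv_nonneg.mpr (pow_nonneg hℓ.le 15))
      _ ≤ |C| * (ell D ^ 7)⁻¹ := mul_le_mul_of_nonneg_left h15le7 (abs_nonneg C)
  have halg : |C| + K * ‖PiW χ d r‖ ≤ (|C| + K) * (1 + ‖PiW χ d r‖) := by
    nlinarith [abs_nonneg C, mul_nonneg hK0 hPi, mul_nonneg (abs_nonneg C) hPi]
  calc ‖frakv2 c' χ j d r‖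
      ≤ ‖frakv2 c' χ j d r - (500 : ℂ) * deriv χ.LFunction 1 * PiW χ d r / (Real.log (bigP D) : ℂ) *
            (-1 + fraky1 c' D j ((d * r : ℕ) : ℝ))‖ +
          ‖(500 : ℂ) * deriv χ.LFunction 1 * PiW χ d r / (Real.log (bigP D) : ℂ) *
            (-1 + fraky1 c' D j ((d * r : ℕ) : ℝ))‖ := norm_le_norm_sub_add _ _
    _ ≤ |C| * (ell D ^ 7)⁻¹ + K * ‖PiW χ d r‖ * (ell D ^ 7)⁻¹ := add_le_add key' hmain
    _ = (|C| + K * ‖PiW χ d r‖) * (ell D ^ 7)⁻¹ := by ring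
    _ ≤ (|C| + K) * (1 + ‖PiW χ d r‖) * (ell D ^ 7)⁻¹ := mul_le_mul_of_nonneg_right halg h7

end MiddleWindow

end Literature.NumberTheory.LFunctions.Zhang2022.Typed.Sec10A
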